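import Literature.MathematicalPhysics.KineticTheory.InfiniteChainGibbsUniqueness
import Literature.MathematicalPhysics.KineticTheory.InfiniteChainShiftInvariantUniqueness
import HarnessLib

/-!
# Tight DLR states of the pinned anharmonic chain are regular

Topic `Literature/MathematicalPhysics/KineticTheory`; theorems only (no definitions, no named
facts). Two corollaries joining the two DLR-uniqueness theorems of the one-dimensional chain that
entered the library on 2026-08-16 —
`OscillatorChain.eq_of_isChainGibbsMeasure_of_tight(_pinnedChain)` (`InfiniteChainGibbsUniqueness`:
DLR states with uniformly tight one-site position marginals coincide) and
`OscillatorChain.eq_of_isChainGibbsMeasure_of_isShiftInvariant(_pinnedChain)`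
(`InfiniteChainShiftInvariantUniqueness`: shift-invariant DLR states coincide) — with the existence of
the shift-invariant superstable transfer-operator Markov state
(`InfiniteChainGibbsExistenceShift`):

* `oneSiteTight_of_isShiftInvariant` — a shift-invariant probability measure on `ℤ → ℝ × ℝ` has
  uniformly tight one-site position marginals (`μ{R < |q_x|} = μ{R < |q_0|} → 0`);
* `OscillatorChain.isShiftInvariant_and_hasSuperstabilityEstimate_of_tight_pinnedChain` — a DLR state
  of `pinnedChain ω₂ lam β γ` (`ω₂ > 0`, `lam, β ≥ 0`) at `T > 0` with uniformly tight one-site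
  position marginals IS the Markov state: it is shift-invariant and obeys Buttà–Marchioro's
  superstability estimate (2.3).

These are the "tight ⇒ regular" steps of the witness-regularisation seams of the Fourier's-law
cruxes `GreenKuboContinuation` / `AbelThermodynamicLimit`. [cite: Georgii2011, Thm 10.25 and §11.1]
-/

noncomputable section

open MeasureTheory Set Function Filter Topology
open scoped ENNReal

namespace Literature.MathematicalPhysics.KineticTheory.HeatConduction

/-- **A shift-invariant probability measure has uniformly tight one-site position marginals**:
`∀ ε > 0, ∃ R, ∀ x, μ{σ : R < |q_x(σ)|} ≤ ε` (the one-site law is the same at every site and one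
probability law on `ℝ` is tight). [folklore] -/
theorem oneSiteTight_of_isShiftInvariant {μ : Measure ChainConfig} [IsProbabilityMeasure μ]
    (hS : IsShiftInvariant μ) :
    ∀ ε : ℝ, 0 < ε → ∃ R : ℝ, ∀ x : ℤ, μ {σ : ChainConfig | R < |(σ x).1|} ≤ ENNReal.ofReal ε := by
  intro ε hε
  set S : ℕ → Set ChainConfig := fun N => {σ | (N : ℝ) < |(σ 0).1|} with hSdef
  have hmeas : ∀ N, MeasurableSet (S N) := fun N =>
    measurableSet_lt measurable_const ((measurable_fst.comp (measurable_pi_apply 0)).abs)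
  have hanti : Antitone S := by
    intro N N' hNN' σ hσ
    simp only [hSdef, Set.mem_setOf_eq] at hσ ⊢
    exact lt_of_le_of_lt (by exact_mod_cast hNN') hσ
  have hempty : ⋂ N, S N = ∅ := by
    refine Set.eq_empty_of_forall_notMem fun σ hσ => ?_
    rw [Set.mem_iInter] at hσ
    obtain ⟨N, hN⟩ := exists_nat_gt (|(σ 0).1|)
    have h := hσ N
    simp only [hSdef, Set.mem_setOf_eq] at h
    linarith
  have htend : Tendsto (fun N => μ (S N)) atTop (𝓝 0) := by
    have h := tendsto_measure_iInter_atTop (μ := μ) (fun N => (hmeas N).nullMeasurableSet) hanti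
      ⟨0, measure_ne_top μ _⟩
    rwa [hempty, measure_empty] at h
  have hev : ∀ᶠ N in atTop, μ (S N) < ENNReal.ofReal ε :=
    htend (Iio_mem_nhds (ENNReal.ofReal_pos.2 hε))
  obtain ⟨N, hN⟩ := hev.exists
  refine ⟨N, fun x => ?_⟩
  have hB : MeasurableSet {z : ℝ × ℝ | (N : ℝ) < |z.1|} :=
    measurableSet_lt measurable_const measurable_fst.abs
  have hx : μ {σ : ChainConfig | (N : ℝ) < |(σ x).1|} = μ (S N) :=
    measure_setOf_apply_mem_eq_of_isShiftInvariant hS hB x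
  rw [hx]
  exact hN.le

namespace OscillatorChain

/-- **A tight DLR state of the pinned anharmonic chain is regular**: for `pinnedChain ω₂ lam β γ`
(`ω₂ > 0`, `lam, β ≥ 0`) and `T > 0`, a DLR Gibbs state with uniformly tight one-site position
marginals is shift-invariant and satisfies Buttà–Marchioro's superstability estimate (2.3) — it
coincides with the transfer-operator Markov state (tight-uniqueness
`eq_of_isChainGibbsMeasure_of_tight_pinnedChain` + existence
`exists_isChainGibbsMeasure_shiftInvariant_superstable_pinnedChain` + `oneSiteTight_of_isShiftInvariant`).
[cite: Georgii2011, Thm 10.25 and §11.1] -/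
theorem isShiftInvariant_and_hasSuperstabilityEstimate_of_tight_pinnedChain {ω₂ lam β : ℝ} (γ : ℝ)
    (hω : 0 < ω₂) (hl : 0 ≤ lam) (hβ : 0 ≤ β) {T : ℝ} (hT : 0 < T) {μ : Measure ChainConfig}
    (hμ : (pinnedChain ω₂ lam β γ).IsChainGibbsMeasure T μ)
    (ht : ∀ ε : ℝ, 0 < ε → ∃ R : ℝ, ∀ x : ℤ, μ {σ : ChainConfig | R < |(σ x).1|} ≤ ENNReal.ofReal ε) :
    IsShiftInvariant μ ∧ (pinnedChain ω₂ lam β γ).HasSuperstabilityEstimate μ := by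
  obtain ⟨μ₀, h₀, hS₀, hSS₀⟩ :=
    exists_isChainGibbsMeasure_shiftInvariant_superstable_pinnedChain γ hω hl hβ hT
  haveI : IsProbabilityMeasure μ₀ := h₀.1
  have hμ₀ : μ = μ₀ :=
    eq_of_isChainGibbsMeasure_of_tight_pinnedChain γ hω hl hβ hT hμ h₀ ht
      (oneSiteTight_of_isShiftInvariant hS₀)
  subst hμ₀
  exact ⟨hS₀, hSS₀⟩

end OscillatorChain

end Literature.MathematicalPhysics.KineticTheory.HeatConduction

end
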